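import Literature.Analysis.FluidPDE.TimePeriodicNSLatticeLinearForced
import HarnessLib

/-!
# Time-periodic Navier–Stokes on `T³` in space–time Fourier coefficients: the lattice equation of a
# classical solution of the LINEARISED periodic problem (classical → lattice; converse of
# `TimePeriodicNSLatticeLinearForced`) (Iooss 1972 §3; Henry 1981 Lemma 8.3.1; Kielhöfer 2012 §I.8)

Analysis/FluidPDE proof file (theorems only; no definitions, no named facts), a supplement to
`TimePeriodicNSLatticeOrbit` (the nonlinear orbit, classical → lattice) and `TimePeriodicNSLatticeLinearForced`
(the linearised problem, lattice → classical).  Around a jointly smooth `τ`-periodic field `u` on `T³ × ℝ`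
(e.g. a classical `τ`-periodic Navier–Stokes orbit), a jointly smooth `τ`-periodic complex solution `w` of the
linearised problem `∂ₜw = L_{u(t)} w − ∇q + g`, `L_{u} w = νΔw − (u·∇)w − (w·∇)u` (`Torus.linearizedNSOperator`),
with a smooth pressure `q` and a jointly smooth `τ`-periodic inhomogeneity `g`, is read on the space–time torus
`T⁴` (`W = timeRoll τ w`, `U = timeRoll τ u`, `Gc = timeRoll τ g`); its coefficients `ŵ = 𝓕W` solve the
**linearised projected lattice equation** (`k ≠ 0`; `û = 𝓕(U − m₀)`, `m₀ = ∫ u(0)`, `ĝ = 𝓕Gc`)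
`(2πi τ⁻¹ n + 4π²ν|k|² + 2πi m₀·k) ŵ + Π_k (N(û, ŵ) + N(ŵ, û)) = Π_k ĝ(n,k)` — the converse of
`linear_classical_forced`:

* §A complex twins of the coefficient calculus of `TimePeriodicNSLatticeOrbit` (transversality of
  divergence-free complex fields, the Leray multiplier kills curl-free complex fields);
* §B the **linear rolled-up identity** `a⁻¹∂₀W = νΔₓW − (U·∇ₓ)W − (W·∇ₓ)U − G_Q + Gc` on `T⁴` with curl-free
  slices of `G_Q` and `div_x W = 0` implies the linearised projected lattice equation (`lattice_equation_linear`);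
* §C the classical periodic solution satisfies the hypotheses of §B, the rolled-up pressure gradient `G_Q` being
  *defined* through the equation (`q` itself need not be periodic) and shown to have the gradient slices
  `∇q(τs)` (`linRoll_…`), whence `linear_lattice_of_smooth` / `linear_lattice_of_classical`.

## References

* G. Iooss, *Bifurcation des solutions périodiques de certains problèmes d'évolution*, /
  Arch. Rational Mech. Anal. 47 (1972) 301–329, §2–3. [Iooss1972]
* D. Henry, *Geometric Theory of Semilinear Parabolic Equations*, LNM 840 (1981), Lemma 8.3.1, Thm. 8.3.2. [Henry1981]
* H. Kielhöfer, *Bifurcation Theory*, 2nd ed. (2012), §I.8 (PDF pp. 59–60), §I.12 (pp. 104–105). [Kielhofer2012]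
-/

noncomputable section

open scoped BigOperators Topology ENNReal NNReal ComplexConjugate
open Filter Set Function MeasureTheory UnitAddTorus

namespace Literature.Analysis.FluidPDE

namespace TimePeriodicLattice

open Literature.Analysis.FunctionSpaces Literature.Analysis.FunctionSpaces.Torus
open Literature.Analysis.FunctionSpaces.EuclideanSpace
open Literature.Analysis.FluidPDE.ScalarFourier

-- BODY START
-- NOTATION START
/-- Local notation: the convective symbol on `ℤ × ℤ³` (as in `TimePeriodicNSLattice`). -/
local notation:max "𝐍[" a ", " b "]" m:max =>
  (WithLp.toLp 2 (fun p : Fin 3 => ∑ j : Fin 3, ∑' m' : ℤ × (Fin 3 → ℤ),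
    a m' j * (dsym j (Prod.snd m - Prod.snd m') * b (m - m') p)) : EuclideanSpace ℂ (Fin 3))

/-- Local notation: the lattice family `(n, k) ↦ C (Fin.cons n k)` of a family `C` on `ℤ⁴`. -/
local notation:max "𝐋" C:max => (fun mm : ℤ × (Fin 3 → ℤ) => C (Fin.cons (Prod.fst mm) (Prod.snd mm) : Fin 4 → ℤ))

/-- Local notation: the lattice family `û(n,k) = 𝓕(complexify ∘ (U − m₀))(n,k)` of a real field
`U` on `T⁴` with slice means `m₀`. -/
local notation:max "𝐮[" U ", " m₀ "]" => (fun mm : ℤ × (Fin 3 → ℤ) =>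
  mFourierCoeff (EuclideanSpace.complexify ∘ fun y : UnitAddTorus (Fin 4) => U y - m₀)
    (Fin.cons (Prod.fst mm) (Prod.snd mm) : Fin 4 → ℤ))

/-- Local notation: the rolled-up pressure-gradient field of a `τ`-periodic solution `w` of the
linearised problem around `u` with inhomogeneity `g`, *defined* from the equation:
`G_Q = ν ΔₓW − (U·∇ₓ)W − (W·∇ₓ)U + Gc − τ⁻¹ ∂₀W`, `W = timeRoll τ w`, `U = timeRoll τ u`, `Gc = timeRoll τ g`. -/
local notation:max "𝐐[" ν ", " τ ", " u ", " w ", " g "]" => (fun y : UnitAddTorus (Fin 4) =>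
  ((ν : ℝ) : ℂ) • (∑ i : Fin 3, Torus.partialDeriv (Fin.succ i) (Torus.partialDeriv (Fin.succ i) (Torus.timeRoll τ w)) y) -
    (∑ j : Fin 3, (((Torus.timeRoll τ u y) j : ℝ) : ℂ) • Torus.partialDeriv (Fin.succ j) (Torus.timeRoll τ w) y) -
    (∑ j : Fin 3, ((Torus.timeRoll τ w y) j) •
      EuclideanSpace.complexify (Torus.partialDeriv (Fin.succ j) (Torus.timeRoll τ u) y)) +
    Torus.timeRoll τ g y - ((τ⁻¹ : ℝ) : ℂ) • Torus.partialDeriv 0 (Torus.timeRoll τ w) y)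
-- NOTATION END

/-! ## §A⁹ Complex twins of the coefficient calculus on `T⁴` -/

section Calculus

variable {W : UnitAddTorus (Fin 4) → EuclideanSpace ℂ (Fin 3)}

/-- **Divergence-free complex fields have transversal coefficients**: if `∑ᵢ ∂_{i+1} Wᵢ = 0` on
`T⁴` (complex `W`) then `k · 𝓕W(n,k) = 0`. [folklore] -/
theorem kdot_mFourierCoeff_eq_zero_of_divFreeC (hW : IsSmooth W)
    (hdiv : ∀ y, ∑ i : Fin 3, Torus.partialDeriv (Fin.succ i) (fun z => (W z) i) y = 0) (n : ℤ) (k : Fin 3 → ℤ) :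
    (∑ jj : Fin 3, ((k jj : ℤ) : ℂ) * (mFourierCoeff W (Fin.cons n k)) jj) = 0 := by
  have hWi : ∀ i, IsSmooth (fun y => (W y) i) := isSmooth_apply hW
  set D : UnitAddTorus (Fin 4) → ℂ := fun y => ∑ i : Fin 3, Torus.partialDeriv (Fin.succ i) (fun z => (W z) i) y with hD
  have hD0 : D = 0 := funext fun y => hdiv y
  have hcoef : mFourierCoeff D (Fin.cons n k) = 0 := by rw [hD0]; simp [mFourierCoeff]
  rw [hD, mFourierCoeff_finset_sum Finset.univ (fun i _ => ((hWi i).partialDeriv _).integrable)] at hcoef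
  simp_rw [mFourierCoeff_partialDeriv (hWi _) (Fin.succ _) (Fin.cons n k), Fin.cons_succ, smul_eq_mul,
    mFourierCoeff_apply' hW] at hcoef
  have h2 : (2 * Real.pi * Complex.I : ℂ) ≠ 0 := by simp [Real.pi_ne_zero]
  have : (2 * Real.pi * Complex.I) * (∑ jj : Fin 3, ((k jj : ℤ) : ℂ) * (mFourierCoeff W (Fin.cons n k)) jj) = 0 := by
    rw [Finset.mul_sum, ← hcoef]
    exact Finset.sum_congr rfl fun jj _ => by ring
  exact (mul_eq_zero.1 this).resolve_left h2

/-- **The Leray multiplier kills curl-free complex fields**: if the complex field `G` on `T⁴` has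
`∂_{i+1}Gⱼ = ∂_{j+1}Gᵢ` (its slices are gradients), then `Π_k 𝓕G(n,k) = 0` for `k ≠ 0`. [folklore] -/
theorem lerayCoeff_mFourierCoeff_eq_zero_of_curlFreeC {G : UnitAddTorus (Fin 4) → EuclideanSpace ℂ (Fin 3)} (hG : IsSmooth G)
    (hcurl : ∀ y (i j : Fin 3), Torus.partialDeriv (Fin.succ i) (fun z => G z j) y =
      Torus.partialDeriv (Fin.succ j) (fun z => G z i) y)
    (n : ℤ) {k : Fin 3 → ℤ} (hk : k ≠ 0) :
    Torus.lerayCoeff k (mFourierCoeff G (Fin.cons n k)) = 0 := by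
  have hGi : ∀ i, IsSmooth (fun y => (G y) i) := isSmooth_apply hG
  refine lerayCoeff_eq_zero_of_symm hk fun i j => ?_
  have hfun : Torus.partialDeriv (Fin.succ i) (fun z => (G z) j) = Torus.partialDeriv (Fin.succ j) (fun z => (G z) i) :=
    funext fun y => hcurl y i j
  have hcoef := congrArg (fun g : UnitAddTorus (Fin 4) → ℂ => mFourierCoeff g (Fin.cons n k)) hfun
  simp only at hcoef
  rw [mFourierCoeff_partialDeriv (hGi j), mFourierCoeff_partialDeriv (hGi i), Fin.cons_succ, Fin.cons_succ,
    mFourierCoeff_apply' hG, mFourierCoeff_apply' hG, smul_eq_mul, smul_eq_mul] at hcoef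
  have h2 : (2 * Real.pi * Complex.I : ℂ) ≠ 0 := by simp [Real.pi_ne_zero]
  have : (2 * Real.pi * Complex.I) * (((k i : ℤ) : ℂ) * (mFourierCoeff G (Fin.cons n k)) j) =
      (2 * Real.pi * Complex.I) * (((k j : ℤ) : ℂ) * (mFourierCoeff G (Fin.cons n k)) i) := by
    linear_combination hcoef
  exact mul_left_cancel₀ h2 this

end Calculus

/-! ## §B⁹ From the linear rolled-up identity to the linearised projected lattice equation -/

section RolledUpLinear

variable {U : UnitAddTorus (Fin 4) → EuclideanSpace ℝ (Fin 3)} {W GQ Gc : UnitAddTorus (Fin 4) → EuclideanSpace ℂ (Fin 3)}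
  {m₀ : EuclideanSpace ℝ (Fin 3)} {a ν : ℝ}

/-- **The linearised projected lattice equation of the linear rolled-up identity** (Iooss 1972, §3; Henry 1981,
Lemma 8.3.1, on the Fourier side): if `a⁻¹ ∂₀W = ν ΔₓW − (U·∇ₓ)W − (W·∇ₓ)U − G_Q + Gc` on `T⁴` for a smooth real
`U`, smooth complex `W`, `G_Q`, `Gc` with `div_x W = 0` and curl-free slices of `G_Q`, then for every `m₀ ∈ ℝ³`
and `k ≠ 0`, with `û = 𝓕(U − m₀)`, `ŵ = 𝓕W`, `ĝ = 𝓕Gc`,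
`(2πi a⁻¹ n + 4π²ν|k|² + 2πi m₀·k) ŵ(n,k) + Π_k (N(û,ŵ) + N(ŵ,û))(n,k) = Π_k ĝ(n,k)`. [folklore] -/
theorem lattice_equation_linear (hU : IsSmooth U) (hW : IsSmooth W) (hGQ : IsSmooth GQ) (hGc : IsSmooth Gc)
    (hE : ∀ y, ((a⁻¹ : ℝ) : ℂ) • Torus.partialDeriv 0 W y =
      (ν : ℂ) • (∑ i : Fin 3, Torus.partialDeriv (Fin.succ i) (Torus.partialDeriv (Fin.succ i) W) y) -
        (∑ j : Fin 3, (((U y) j : ℝ) : ℂ) • Torus.partialDeriv (Fin.succ j) W y) -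
        (∑ j : Fin 3, ((W y) j) • complexify (Torus.partialDeriv (Fin.succ j) U y)) - GQ y + Gc y)
    (hdiv : ∀ y, ∑ i : Fin 3, Torus.partialDeriv (Fin.succ i) (fun z => (W z) i) y = 0)
    (hcurl : ∀ y (i j : Fin 3), Torus.partialDeriv (Fin.succ i) (fun z => GQ z j) y =
      Torus.partialDeriv (Fin.succ j) (fun z => GQ z i) y)
    (m : ℤ × (Fin 3 → ℤ)) (hm : m.2 ≠ 0) :
    (2 * Real.pi * Complex.I * ((a⁻¹ : ℝ) : ℂ) * (m.1 : ℂ) + ((4 * Real.pi ^ 2 * ν * freqNormSq m.2 : ℝ) : ℂ) +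
        2 * Real.pi * Complex.I * (∑ jj : Fin 3, ((m₀ jj : ℝ) : ℂ) * ((m.2 jj : ℤ) : ℂ))) • 𝐋 (mFourierCoeff W) m +
      Torus.lerayCoeff m.2 (𝐍[𝐮[U, m₀], 𝐋 (mFourierCoeff W)] m + 𝐍[𝐋 (mFourierCoeff W), 𝐮[U, m₀]] m) =
      Torus.lerayCoeff m.2 (𝐋 (mFourierCoeff Gc) m) := by
  have hV : IsSmooth (fun z => U z - m₀) := hU.sub (isSmooth_const m₀)
  have hVc : IsSmooth (complexify ∘ fun z => U z - m₀) := hV.comp_clm complexify.toContinuousLinearMap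
  -- derivatives of `Vc` are complexified derivatives of `U`
  have hd1 : ∀ j z, Torus.partialDeriv j (complexify ∘ fun z => U z - m₀) z = complexify (Torus.partialDeriv j U z) := by
    intro j z
    have h1 := partialDeriv_clm_comp hV complexify.toContinuousLinearMap j z
    simp only [LinearIsometry.coe_toContinuousLinearMap] at h1; rw [h1, partialDeriv_sub_const]
  -- the fields of the identity
  set Vc : UnitAddTorus (Fin 4) → EuclideanSpace ℂ (Fin 3) := complexify ∘ fun z => U z - m₀ with hVc_def
  set L : UnitAddTorus (Fin 4) → EuclideanSpace ℂ (Fin 3) :=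
    fun y => ∑ i : Fin 3, Torus.partialDeriv (Fin.succ i) (Torus.partialDeriv (Fin.succ i) W) y with hL
  set D : UnitAddTorus (Fin 4) → EuclideanSpace ℂ (Fin 3) :=
    fun y => ∑ j : Fin 3, ((m₀ j : ℝ) : ℂ) • Torus.partialDeriv (Fin.succ j) W y with hD
  set T₁ : UnitAddTorus (Fin 4) → EuclideanSpace ℂ (Fin 3) :=
    fun y => ∑ j : Fin 3, (Vc y) j • Torus.partialDeriv (Fin.succ j) W y with hT₁
  set T₂ : UnitAddTorus (Fin 4) → EuclideanSpace ℂ (Fin 3) :=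
    fun y => ∑ j : Fin 3, (W y) j • Torus.partialDeriv (Fin.succ j) Vc y with hT₂
  have hLs : IsSmooth L := isSmooth_fun_finsetSum _ fun i _ => (hW.partialDeriv _).partialDeriv _
  have hDs : IsSmooth D := isSmooth_fun_finsetSum _ fun j _ => isSmooth_smul_complex (isSmooth_const _) (hW.partialDeriv _)
  have hT₁s : IsSmooth T₁ := isSmooth_transport hVc hW
  have hT₂s : IsSmooth T₂ := isSmooth_transport hW hVc
  -- `(U·∇)W = D + T₁`, `(W·∇)U = T₂`
  have hDT : ∀ y, D y + T₁ y = ∑ j : Fin 3, (((U y) j : ℝ) : ℂ) • Torus.partialDeriv (Fin.succ j) W y := by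
    intro y
    simp only [hD, hT₁, ← Finset.sum_add_distrib]
    refine Finset.sum_congr rfl fun j _ => ?_
    rw [← add_smul, hVc_def, Function.comp_apply, complexify_apply, PiLp.sub_apply, Complex.ofReal_sub, add_sub_cancel]
  have hT₂' : ∀ y, T₂ y = ∑ j : Fin 3, (W y) j • complexify (Torus.partialDeriv (Fin.succ j) U y) := fun y => by
    simp only [hT₂]; exact Finset.sum_congr rfl fun j _ => by rw [hd1]
  have hid : ∀ y, ((a⁻¹ : ℝ) : ℂ) • Torus.partialDeriv 0 W y = (ν : ℂ) • L y - D y - T₁ y - T₂ y - GQ y + Gc y := by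
    intro y; rw [hE y, ← hDT y, hT₂' y]; simp only [hL]; abel
  -- Fourier coefficients of the identity at `K = (n, k)`
  have hcoef : mFourierCoeff (((a⁻¹ : ℝ) : ℂ) • Torus.partialDeriv 0 W) (Fin.cons m.1 m.2) =
      mFourierCoeff (fun y => (ν : ℂ) • L y - D y - T₁ y - T₂ y - GQ y + Gc y) (Fin.cons m.1 m.2) := by
    congr 1; funext y; exact hid y
  set v : EuclideanSpace ℂ (Fin 3) := mFourierCoeff W (Fin.cons m.1 m.2) with hv
  have cL : mFourierCoeff L (Fin.cons m.1 m.2) = (((-(4 * Real.pi ^ 2 * freqNormSq m.2)) : ℝ) : ℂ) • v :=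
    mFourierCoeff_laplacianX_cons hW m.1 m.2
  have cD : mFourierCoeff D (Fin.cons m.1 m.2) =
      (2 * Real.pi * Complex.I * (∑ jj : Fin 3, ((m₀ jj : ℝ) : ℂ) * ((m.2 jj : ℤ) : ℂ))) • v := by
    have hint : ∀ j : Fin 3, Integrable (fun y => ((m₀ j : ℝ) : ℂ) • Torus.partialDeriv (Fin.succ j) W y) volume :=
      fun j => (((hW.partialDeriv (Fin.succ j)).continuous.const_smul ((m₀ j : ℝ) : ℂ) :)).integrable_unitAddTorus
    rw [hD, mFourierCoeff_finset_sum Finset.univ (fun j _ => hint j)]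
    have : ∀ j : Fin 3, mFourierCoeff (fun y => ((m₀ j : ℝ) : ℂ) • Torus.partialDeriv (Fin.succ j) W y) (Fin.cons m.1 m.2) =
        (((m₀ j : ℝ) : ℂ) * dsym j m.2) • v := by
      intro j
      rw [show (fun y => ((m₀ j : ℝ) : ℂ) • Torus.partialDeriv (Fin.succ j) W y) =
          ((m₀ j : ℝ) : ℂ) • Torus.partialDeriv (Fin.succ j) W from rfl, mFourierCoeff_const_smul,
        mFourierCoeff_partialDeriv_succ_cons hW, smul_smul]
    simp_rw [this, ← Finset.sum_smul]
    congr 1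
    rw [Finset.mul_sum]
    exact Finset.sum_congr rfl fun j _ => by rw [dsym_apply]; ring
  have cT₁ : mFourierCoeff T₁ (Fin.cons m.1 m.2) = 𝐍[𝐮[U, m₀], 𝐋 (mFourierCoeff W)] m :=
    mFourierCoeff_transport_cons hVc hW m.1 m.2
  have cT₂ : mFourierCoeff T₂ (Fin.cons m.1 m.2) = 𝐍[𝐋 (mFourierCoeff W), 𝐮[U, m₀]] m :=
    mFourierCoeff_transport_cons hW hVc m.1 m.2
  have cG : Torus.lerayCoeff m.2 (mFourierCoeff GQ (Fin.cons m.1 m.2)) = 0 :=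
    lerayCoeff_mFourierCoeff_eq_zero_of_curlFreeC hGQ hcurl m.1 hm
  set N₁ : EuclideanSpace ℂ (Fin 3) := 𝐍[𝐮[U, m₀], 𝐋 (mFourierCoeff W)] m with hN₁
  set N₂ : EuclideanSpace ℂ (Fin 3) := 𝐍[𝐋 (mFourierCoeff W), 𝐮[U, m₀]] m with hN₂
  rw [mFourierCoeff_const_smul, mFourierCoeff_partialDeriv_zero_cons hW, mFourierCoeff_lincomb₆ hLs.integrable
    hDs.integrable hT₁s.integrable hT₂s.integrable hGQ.integrable hGc.integrable, cL, cD, cT₁, cT₂] at hcoef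
  rw [← hv] at hcoef
  -- the Leray multiplier as a linear map, and its values on the pieces
  let P : EuclideanSpace ℂ (Fin 3) →ₗ[ℂ] EuclideanSpace ℂ (Fin 3) :=
    { toFun := Torus.lerayCoeff m.2, map_add' := SteadyLattice.lerayCoeff_add' m.2,
      map_smul' := SteadyLattice.lerayCoeff_smul' m.2 }
  have hP : ∀ x, P x = Torus.lerayCoeff m.2 x := fun x => rfl
  have Pv : Torus.lerayCoeff m.2 v = v :=
    SteadyLattice.lerayCoeff_of_kdot_eq_zero hm (kdot_mFourierCoeff_eq_zero_of_divFreeC hW hdiv m.1 m.2)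
  have h := congrArg P hcoef
  simp only [map_smul, map_sub, map_add] at h; simp only [hP, Pv, cG, sub_zero] at h
  rw [SteadyLattice.lerayCoeff_add']
  set PN₁ : EuclideanSpace ℂ (Fin 3) := Torus.lerayCoeff m.2 N₁ with hPN₁
  set PN₂ : EuclideanSpace ℂ (Fin 3) := Torus.lerayCoeff m.2 N₂ with hPN₂
  set Pg : EuclideanSpace ℂ (Fin 3) := Torus.lerayCoeff m.2 (mFourierCoeff Gc (Fin.cons m.1 m.2)) with hPg
  -- scalar bookkeeping, coordinatewise
  ext i
  have hi := congrArg (fun x : EuclideanSpace ℂ (Fin 3) => x i) h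
  simp only [PiLp.add_apply, PiLp.sub_apply, PiLp.smul_apply, smul_eq_mul] at hi ⊢
  push_cast at hi ⊢
  linear_combination hi

end RolledUpLinear

/-! ## §C⁹ The classical periodic solution of the linearised problem -/

section LinearRoll

variable {ν τ : ℝ} {f : UnitAddTorus (Fin 3) → EuclideanSpace ℝ (Fin 3)}
  {u : ℝ → UnitAddTorus (Fin 3) → EuclideanSpace ℝ (Fin 3)} {p : ℝ → UnitAddTorus (Fin 3) → ℝ}
  {w g : ℝ → UnitAddTorus (Fin 3) → EuclideanSpace ℂ (Fin 3)} {q : ℝ → UnitAddTorus (Fin 3) → ℂ}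

/-- **The linear rolled-up identity** `τ⁻¹∂₀W = νΔₓW − (U·∇ₓ)W − (W·∇ₓ)U − G_Q + Gc` (by the
definition of `G_Q`). [folklore] -/
theorem linRoll_E (y : UnitAddTorus (Fin 4)) :
    ((τ⁻¹ : ℝ) : ℂ) • Torus.partialDeriv 0 (timeRoll τ w) y =
      (ν : ℂ) • (∑ i : Fin 3, Torus.partialDeriv (Fin.succ i) (Torus.partialDeriv (Fin.succ i) (timeRoll τ w)) y) -
        (∑ j : Fin 3, (((timeRoll τ u y) j : ℝ) : ℂ) • Torus.partialDeriv (Fin.succ j) (timeRoll τ w) y) -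
        (∑ j : Fin 3, ((timeRoll τ w y) j) • complexify (Torus.partialDeriv (Fin.succ j) (timeRoll τ u) y)) -
        𝐐[ν, τ, u, w, g] y + timeRoll τ g y := by
  have key : ∀ L C S G E : EuclideanSpace ℂ (Fin 3), E = L - C - S - (L - C - S + G - E) + G := fun _ _ _ _ _ => by abel
  exact key _ _ _ _ _

/-- **The rolled-up pressure gradient is the slice gradient**: `G_Q(↑s, x) = ∇q(τs)(x)` (the
linearised equation at `t = τ s`). [folklore] -/
theorem linRoll_G_cons (hτ : 0 < τ) (hper : Function.Periodic u τ) (hws : IsSmoothSpaceTimeOn univ w)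
    (hwper : Function.Periodic w τ) (hgper : Function.Periodic g τ)
    (heq : ∀ t x, timeDerivWithin univ w t x = Torus.linearizedNSOperator ν (u t) (w t) (q t) x + g t x)
    (s : ℝ) (x : UnitAddTorus (Fin 3)) :
    𝐐[ν, τ, u, w, g] (Fin.cons ((s : ℝ) : UnitAddCircle) x) = Torus.gradientC (q (τ * s)) x := by
  have hW : IsSmooth (timeRoll τ w) := isSmooth_timeRoll hws hwper
  have hlap : (∑ i : Fin 3, Torus.partialDeriv (Fin.succ i) (Torus.partialDeriv (Fin.succ i) (timeRoll τ w))
      (Fin.cons ((s : ℝ) : UnitAddCircle) x)) = Torus.laplacian (w (τ * s)) x := by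
    rw [← laplacian_timeSlice hW, timeSlice_timeRoll hwper]
  have hconv : (∑ j : Fin 3, (((timeRoll τ u (Fin.cons ((s : ℝ) : UnitAddCircle) x)) j : ℝ) : ℂ) •
      Torus.partialDeriv (Fin.succ j) (timeRoll τ w) (Fin.cons ((s : ℝ) : UnitAddCircle) x)) =
      Torus.convect (u (τ * s)) (w (τ * s)) x := by
    rw [← timeSlice_timeRoll hper s, ← timeSlice_timeRoll hwper s, convect_timeSlice hW]
    exact Finset.sum_congr rfl fun j _ => Complex.coe_smul _ _
  have hstr : (∑ j : Fin 3, ((timeRoll τ w (Fin.cons ((s : ℝ) : UnitAddCircle) x)) j) •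
      complexify (Torus.partialDeriv (Fin.succ j) (timeRoll τ u) (Fin.cons ((s : ℝ) : UnitAddCircle) x))) =
      Torus.stretch (w (τ * s)) (u (τ * s)) x := by
    rw [Torus.stretch, timeRoll_cons hwper]
    refine Finset.sum_congr rfl fun j _ => ?_
    rw [SteadyLattice.realToComplex_eq_complexify, ← timeSlice_timeRoll hper s, ← partialDeriv_succ_cons]
  have e1 : ((τ⁻¹ : ℝ) : ℂ) • (τ • timeDerivWithin univ w (τ * s) x) = timeDerivWithin univ w (τ * s) x := by
    rw [Complex.coe_smul, smul_smul, inv_mul_cancel₀ hτ.ne', one_smul]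
  simp only
  rw [hlap, hconv, hstr, timeRoll_cons hgper, partialDeriv_zero_timeRoll hws hwper, e1, Complex.coe_smul,
    heq (τ * s) x, Torus.linearizedNSOperator_apply]
  abel

/-- The rolled-up pressure gradient is smooth on `T⁴`. [folklore] -/
theorem linRoll_isSmooth_G (hsu : IsSmoothSpaceTimeOn univ u) (hper : Function.Periodic u τ)
    (hws : IsSmoothSpaceTimeOn univ w) (hwper : Function.Periodic w τ)
    (hgs : IsSmoothSpaceTimeOn univ g) (hgper : Function.Periodic g τ) :
    IsSmooth 𝐐[ν, τ, u, w, g] := by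
  have hU : IsSmooth (timeRoll τ u) := isSmooth_timeRoll hsu hper
  have hW : IsSmooth (timeRoll τ w) := isSmooth_timeRoll hws hwper
  have hL : IsSmooth (fun y => ∑ i : Fin 3, Torus.partialDeriv (Fin.succ i) (Torus.partialDeriv (Fin.succ i) (timeRoll τ w)) y) :=
    isSmooth_fun_finsetSum _ fun i _ => (hW.partialDeriv _).partialDeriv _
  have hC : IsSmooth (fun y => ∑ j : Fin 3, (((timeRoll τ u y) j : ℝ) : ℂ) • Torus.partialDeriv (Fin.succ j) (timeRoll τ w) y) :=
    isSmooth_fun_finsetSum _ fun j _ => isSmooth_smul_complex (isSmooth_ofReal_apply hU j) (hW.partialDeriv _)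
  have hd : ∀ j, IsSmooth (fun y => complexify (Torus.partialDeriv (Fin.succ j) (timeRoll τ u) y)) := fun j => by
    have h := (hU.partialDeriv (Fin.succ j)).comp_clm complexify.toContinuousLinearMap
    simp only [LinearIsometry.coe_toContinuousLinearMap] at h; exact h
  have hS : IsSmooth (fun y => ∑ j : Fin 3, ((timeRoll τ w y) j) • complexify (Torus.partialDeriv (Fin.succ j) (timeRoll τ u) y)) :=
    isSmooth_fun_finsetSum _ fun j _ => isSmooth_smul_complex (isSmooth_apply hW j) (hd j)
  have hG : IsSmooth (timeRoll τ g) := isSmooth_timeRoll hgs hgper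
  have hT : IsSmooth (fun y => ((τ⁻¹ : ℝ) : ℂ) • Torus.partialDeriv 0 (timeRoll τ w) y) :=
    isSmooth_smul_complex (isSmooth_const _) (hW.partialDeriv 0)
  exact ((((isSmooth_smul_complex (isSmooth_const _) hL).sub hC).sub hS).add hG).sub hT

/-- The rolled-up pressure gradient has curl-free slices (symmetry of the second derivatives of
the smooth complex pressure `q(τs)`). [folklore] -/
theorem linRoll_curl (hτ : 0 < τ) (hper : Function.Periodic u τ) (hws : IsSmoothSpaceTimeOn univ w)
    (hwper : Function.Periodic w τ) (hqs : IsSmoothSpaceTimeOn univ q) (hgper : Function.Periodic g τ)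
    (heq : ∀ t x, timeDerivWithin univ w t x = Torus.linearizedNSOperator ν (u t) (w t) (q t) x + g t x)
    (y : UnitAddTorus (Fin 4)) (i j : Fin 3) :
    Torus.partialDeriv (Fin.succ i) (fun z => 𝐐[ν, τ, u, w, g] z j) y =
      Torus.partialDeriv (Fin.succ j) (fun z => 𝐐[ν, τ, u, w, g] z i) y := by
  obtain ⟨s, x, rfl⟩ := exists_eq_cons y
  have hq : IsSmooth (q (τ * s)) := hqs.isSmooth_slice (mem_univ _)
  have hsl : ∀ l : Fin 3, timeSlice (fun z => 𝐐[ν, τ, u, w, g] z l) ((s : ℝ) : UnitAddCircle) =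
      Torus.partialDeriv l (q (τ * s)) := by
    intro l; funext x'
    rw [timeSlice_apply, linRoll_G_cons hτ hper hws hwper hgper heq s x']; rfl
  rw [partialDeriv_succ_cons, partialDeriv_succ_cons, hsl, hsl]
  exact Torus.partialDeriv_comm hq i j x

/-- The rolled-up solution is divergence free in the spatial variables. [folklore] -/
theorem linRoll_div (hwper : Function.Periodic w τ) (hwdiv : ∀ t, Torus.IsDivFreeC (w t)) (y : UnitAddTorus (Fin 4)) :
    ∑ i : Fin 3, Torus.partialDeriv (Fin.succ i) (fun z => (timeRoll τ w z) i) y = 0 := by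
  obtain ⟨s, x, rfl⟩ := exists_eq_cons y
  have h := hwdiv (τ * s) x
  rw [Torus.divergenceC] at h
  rw [← h]
  refine Finset.sum_congr rfl fun i _ => ?_
  rw [partialDeriv_succ_cons]; congr 1; funext x'; rw [timeSlice_apply, timeRoll_cons hwper]

/-- The slices of the rolled-up solution have mean zero. [folklore] -/
theorem linRoll_sliceMean (hwper : Function.Periodic w τ) (hw0 : ∀ t, HasZeroMean (w t)) (c : UnitAddCircle) :
    (∫ x, timeSlice (timeRoll τ w) c x) = 0 := by
  obtain ⟨s, rfl⟩ := QuotientAddGroup.mk_surjective c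
  rw [show (QuotientAddGroup.mk s : UnitAddCircle) = ((s : ℝ) : UnitAddCircle) from rfl, timeSlice_timeRoll hwper]
  exact hw0 _

/-- **Lattice data of the linearised solution, (i)**: zero spatial modes vanish. [folklore] -/
theorem linRoll_zero_modes (hws : IsSmoothSpaceTimeOn univ w) (hwper : Function.Periodic w τ)
    (hw0 : ∀ t, HasZeroMean (w t)) (n : ℤ) :
    𝐋 (mFourierCoeff (timeRoll τ w)) ((n, 0) : ℤ × (Fin 3 → ℤ)) = 0 := by
  have h := mFourierCoeff_cons_zero_of_integral_timeSlice _ (isSmooth_timeRoll hws hwper).continuous (M := 0)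
    (linRoll_sliceMean hwper hw0) n
  simpa using h

/-- **Lattice data of the linearised solution, (ii)**: transversality. [folklore] -/
theorem linRoll_transversal (hws : IsSmoothSpaceTimeOn univ w) (hwper : Function.Periodic w τ)
    (hwdiv : ∀ t, Torus.IsDivFreeC (w t)) (m : ℤ × (Fin 3 → ℤ)) :
    (∑ jj : Fin 3, ((m.2 jj : ℤ) : ℂ) * (𝐋 (mFourierCoeff (timeRoll τ w)) m) jj) = 0 :=
  kdot_mFourierCoeff_eq_zero_of_divFreeC (isSmooth_timeRoll hws hwper) (linRoll_div hwper hwdiv) m.1 m.2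

/-- **Lattice data of the linearised solution, (iii)**: rapid decay of the coefficient family on `ℤ⁴`. [folklore] -/
theorem linRoll_rapidDecay (hws : IsSmoothSpaceTimeOn univ w) (hwper : Function.Periodic w τ) :
    RapidDecay (mFourierCoeff (timeRoll τ w)) :=
  (isSmooth_timeRoll hws hwper).rapidDecay_mFourierCoeff

/-- **Lattice data of the linearised solution, (iv): the linearised projected lattice equation** around a
jointly smooth `τ`-periodic field `u`: for a jointly smooth `τ`-periodic divergence-free complex solution `w` of
`∂ₜw = L_{u(t)} w − ∇q + g` (smooth pressure `q`, jointly smooth `τ`-periodic `g`) and `k ≠ 0`,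
`(2πi τ⁻¹ n + 4π²ν|k|² + 2πi m₀·k) ŵ(n,k) + Π_k (N(û,ŵ) + N(ŵ,û))(n,k) = Π_k ĝ(n,k)` with `ŵ = 𝓕(timeRoll τ w)`,
`û = 𝓕(timeRoll τ u − m₀)`, `m₀ = ∫ u(0)`, `ĝ = 𝓕(timeRoll τ g)` (Iooss 1972, §3; Henry 1981, Lemma 8.3.1). [folklore] -/
theorem linear_lattice_of_smooth (hτ : 0 < τ) (hsu : IsSmoothSpaceTimeOn univ u) (hper : Function.Periodic u τ)
    (hws : IsSmoothSpaceTimeOn univ w) (hwper : Function.Periodic w τ) (hqs : IsSmoothSpaceTimeOn univ q)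
    (hgs : IsSmoothSpaceTimeOn univ g) (hgper : Function.Periodic g τ)
    (heq : ∀ t x, timeDerivWithin univ w t x = Torus.linearizedNSOperator ν (u t) (w t) (q t) x + g t x)
    (hwdiv : ∀ t, Torus.IsDivFreeC (w t)) (m : ℤ × (Fin 3 → ℤ)) (hm : m.2 ≠ 0) :
    (2 * Real.pi * Complex.I * ((τ⁻¹ : ℝ) : ℂ) * (m.1 : ℂ) + ((4 * Real.pi ^ 2 * ν * freqNormSq m.2 : ℝ) : ℂ) +
        2 * Real.pi * Complex.I * (∑ jj : Fin 3, (((∫ x, u 0 x) jj : ℝ) : ℂ) * ((m.2 jj : ℤ) : ℂ))) •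
        𝐋 (mFourierCoeff (timeRoll τ w)) m +
      Torus.lerayCoeff m.2 (𝐍[𝐮[timeRoll τ u, ∫ x, u 0 x], 𝐋 (mFourierCoeff (timeRoll τ w))] m +
        𝐍[𝐋 (mFourierCoeff (timeRoll τ w)), 𝐮[timeRoll τ u, ∫ x, u 0 x]] m) =
      Torus.lerayCoeff m.2 (𝐋 (mFourierCoeff (timeRoll τ g)) m) :=
  lattice_equation_linear (m₀ := ∫ x, u 0 x) (isSmooth_timeRoll hsu hper) (isSmooth_timeRoll hws hwper)
    (linRoll_isSmooth_G hsu hper hws hwper hgs hgper) (isSmooth_timeRoll hgs hgper) (linRoll_E (g := g))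
    (linRoll_div hwper hwdiv) (linRoll_curl hτ hper hws hwper hqs hgper heq) m hm

/-- **The linearised projected lattice equation of a classical periodic solution of the linearised problem
around a classical `τ`-periodic orbit** `u` of the forced Navier–Stokes system (same normalisations as
`orbit_equation`: `û = 𝓕(timeRoll τ u − ∫ u(0))`, the symbol `2πi τ⁻¹ n + 4π²ν|k|² + 2πi (∫ u(0))·k`, the Leray
multiplier outside `N`): for `k ≠ 0`, `σ(n,k) ŵ(n,k) + Π_k (N(û,ŵ) + N(ŵ,û))(n,k) = Π_k ĝ(n,k)` — the converse of
`linear_classical_forced` (Iooss 1972, §3; Henry 1981, Lemma 8.3.1). [folklore] -/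
theorem linear_lattice_of_classical (hτ : 0 < τ) (hsol : Torus.IsClassicalNSSolutionOn univ ν (fun _ => f) u p)
    (hper : Function.Periodic u τ)
    (hws : IsSmoothSpaceTimeOn univ w) (hwper : Function.Periodic w τ) (hqs : IsSmoothSpaceTimeOn univ q)
    (hgs : IsSmoothSpaceTimeOn univ g) (hgper : Function.Periodic g τ)
    (heq : ∀ t x, timeDerivWithin univ w t x = Torus.linearizedNSOperator ν (u t) (w t) (q t) x + g t x)
    (hwdiv : ∀ t, Torus.IsDivFreeC (w t)) (m : ℤ × (Fin 3 → ℤ)) (hm : m.2 ≠ 0) :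
    (2 * Real.pi * Complex.I * ((τ⁻¹ : ℝ) : ℂ) * (m.1 : ℂ) + ((4 * Real.pi ^ 2 * ν * freqNormSq m.2 : ℝ) : ℂ) +
        2 * Real.pi * Complex.I * (∑ jj : Fin 3, (((∫ x, u 0 x) jj : ℝ) : ℂ) * ((m.2 jj : ℤ) : ℂ))) •
        𝐋 (mFourierCoeff (timeRoll τ w)) m +
      Torus.lerayCoeff m.2 (𝐍[𝐮[timeRoll τ u, ∫ x, u 0 x], 𝐋 (mFourierCoeff (timeRoll τ w))] m +
        𝐍[𝐋 (mFourierCoeff (timeRoll τ w)), 𝐮[timeRoll τ u, ∫ x, u 0 x]] m) =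
      Torus.lerayCoeff m.2 (𝐋 (mFourierCoeff (timeRoll τ g)) m) :=
  linear_lattice_of_smooth hτ hsol.smooth_velocity hper hws hwper hqs hgs hgper heq hwdiv m hm

end LinearRoll

end TimePeriodicLattice

end Literature.Analysis.FluidPDE
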